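import Summits.CriticalPhenomena.Ising3DConformalLimit.Theorems.PrecisionLaplacianDirectCorrelationStableTailPickInversionAux14
import Summits.CriticalPhenomena.Ising3DConformalLimit.Theorems.PrecisionLaplacianDirectCorrelationStableTailPickInversionAux16
import Summits.CriticalPhenomena.Ising3DConformalLimit.Theorems.PrecisionLaplacianEtaBoundsTransferLimit
import Summits.CriticalPhenomena.Ising3DConformalLimit.Theorems.PrecisionLaplacianDirectCorrelationStableTailScaleRegularityAux4

/-!
# Pick inversion, auxiliary file 17: reflection symmetry of the direct correlation function,
# weak closure of the slab representation, and the slab modes at a good transverse momentum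

Helper file for stub `stub_pickInversion` of line `self-energy-pick-inversion`, crux
`PrecisionLaplacian.DirectCorrelationStableTail` (stmt-CriticalPhenomena-4799). Pure theorem file.

* `a_reflect` : for a kernel `G` invariant under the reflection of a coordinate, the direct
  correlation function `a` (infimum over finite volumes of `-(M_A)⁻¹(0, ·)`) is invariant too
  (reindex the boxes, as in `EtaBoundsTransfer.a_neg`);
* `slabHausdorff_of_limit` : the Hausdorff moment property of `n ↦ F (n+1) k` passes to limits
  `k_m → k` when the `F n` are continuous and uniformly bounded (`exists_hausdorffMeasure_of_momentLimit`);
* `slabMoments_of_openCube` (registered sub-goal `stub_pickInversion_auxGoodMomentum`): for the Green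
  function of an even sub-stochastic step law `q` on `ℤ³`, positive at the unit vectors, whose slab
  quadratic forms are Hausdorff moment sequences, at every `k₀` of the open cube off the axes
  `{k_j = 0}` the symbol is `< 1` on the slab circle and the slab transforms `(h_n(k₀))_n` form a
  Hausdorff moment sequence (files 12–14, 16);
* `exists_reduce_approx`, `tsum_mul_cos_periodic` : reduction of an arbitrary momentum to limits of
  such `k₀` modulo `2πℤ²`.
-/

noncomputable section

namespace Summit.CriticalPhenomena.Ising3DConformalLimit.Cruxes.DirectCorrelationStableTail.SelfEnergyPickInversion

open Filter Topology Finset Real MeasureTheory Literature.Probability.LatticeModels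
open scoped BigOperators
open Summit.CriticalPhenomena.Ising3DConformalLimit.Theorems.EtaBoundsTransfer
  (continuous_phase continuous_fourier_q abs_fourier_q_le_one kerMat_apply tendsto_t)

/-! ### Reflection symmetry of the direct correlation function -/

section Reflect

variable {d : ℕ} {G : Site d → ℝ} {M : (A : Finset (Site d)) → Matrix A A ℝ}
  {t : ℕ → Site d → ℝ} {a : Site d → ℝ}

/-- The coordinate reflection preserves boxes. [folklore] -/
theorem update_neg_mem_box (j : Fin d) {L : ℕ} {x : Site d} (hx : x ∈ box d L) :
    Function.update x j (-x j) ∈ box d L := by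
  rw [mem_box] at hx ⊢
  intro i
  by_cases hi : i = j
  · subst hi; simp only [Function.update_self]; have := hx i; omega
  · rw [Function.update_of_ne hi]; exact hx i

/-- **Reflection symmetry of the inverse kernel matrix**: if `G` is invariant under the reflection
`R_j` of the `j`-th coordinate and `A` is `R_j`-symmetric, then `(M A)⁻¹ (R_j x) (R_j y) = (M A)⁻¹ x y`.
[folklore] -/
theorem inv_kerMat_reflect (hM : ∀ A, M A = Matrix.of fun (p q : ↥A) => G (q.1 - p.1)) (j : Fin d)
    (hGR : ∀ x, G (Function.update x j (-x j)) = G x) {A : Finset (Site d)}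
    (hA : ∀ x, x ∈ A → Function.update x j (-x j) ∈ A) {x y : Site d} (hx : x ∈ A) (hy : y ∈ A) :
    (M A)⁻¹ ⟨Function.update x j (-x j), hA x hx⟩ ⟨Function.update y j (-y j), hA y hy⟩ =
      (M A)⁻¹ ⟨x, hx⟩ ⟨y, hy⟩ := by
  have hinv : ∀ z : Site d, Function.update (Function.update z j (-z j)) j (-(Function.update z j (-z j)) j) = z := by
    intro z; ext i
    by_cases hi : i = j
    · subst hi; simp
    · simp [Function.update_of_ne hi]
  set e : ↥A ≃ ↥A :=
    { toFun := fun p => ⟨Function.update p.1 j (-p.1 j), hA _ p.2⟩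
      invFun := fun p => ⟨Function.update p.1 j (-p.1 j), hA _ p.2⟩
      left_inv := fun p => by ext1; exact hinv p.1
      right_inv := fun p => by ext1; exact hinv p.1 } with he
  have hsub : M A = (M A).submatrix e e := by
    ext p q
    simp only [Matrix.submatrix_apply, kerMat_apply hM, he, Equiv.coe_fn_mk]
    rw [← hGR (q.1 - p.1)]
    congr 1
    ext i
    by_cases hi : i = j
    · subst hi; simp; ring
    · simp [Function.update_of_ne hi]
  have h := congr_arg (fun N : Matrix A A ℝ => N⁻¹ ⟨x, hx⟩ ⟨y, hy⟩) hsub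
  simp only [Matrix.inv_submatrix_equiv, Matrix.submatrix_apply] at h
  rw [h]
  rfl

/-- **Reflection symmetry of the direct correlation function**: `a (R_j y) = a y` for `y ≠ 0`.
[folklore] -/
theorem a_reflect (hM : ∀ A, M A = Matrix.of fun (p q : ↥A) => G (q.1 - p.1))
    (hSP : ∀ A : Finset (Site d), (M A).PosDef ∧
      ∀ u v : ↥A, (u ≠ v → (M A)⁻¹ u v ≤ 0) ∧ 0 ≤ ∑ w, (M A)⁻¹ u w)
    (ht : ∀ n y (hy : y ∈ box d n), t n y = -(M (box d n))⁻¹ ⟨0, zero_mem_box d n⟩ ⟨y, hy⟩)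
    (ha : ∀ y, a y = ⨅ A : {A : Finset (Site d) // (0 : Site d) ∈ A ∧ y ∈ A},
      -((M A.1)⁻¹ ⟨0, A.2.1⟩ ⟨y, A.2.2⟩))
    (j : Fin d) (hGR : ∀ x, G (Function.update x j (-x j)) = G x)
    {y : Site d} (hy0 : y ≠ 0) : a (Function.update y j (-y j)) = a y := by
  have hR0 : Function.update y j (-y j) ≠ 0 := by
    intro h
    apply hy0
    ext i
    have hi := congrFun h i
    by_cases hij : i = j
    · subst hij; simpa using hi
    · rwa [Function.update_of_ne hij] at hi
  have h1 := tendsto_t hM hSP ht ha hy0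
  have h2 := tendsto_t hM hSP ht ha hR0
  have h3 : (fun n => t n (Function.update y j (-y j))) =ᶠ[atTop] fun n => t n y := by
    filter_upwards [eventually_ge_atTop (Site.supNorm y)] with n hn
    have hy : y ∈ box d n := mem_box_iff_supNorm_le.2 hn
    rw [ht n y hy, ht n _ (update_neg_mem_box j hy)]
    have h := inv_kerMat_reflect hM j hGR (A := box d n) (fun x hx => update_neg_mem_box j hx) (zero_mem_box d n) hy
    have h0 : Function.update (0 : Site d) j (-(0 : Site d) j) = 0 := by ext i; by_cases hi : i = j <;> simp [hi]
    simp only [h0] at h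
    rw [h]
  exact tendsto_nhds_unique (h2.congr' h3) h1

end Reflect

/-! ### Weak closure of the slab representation -/

/-- **Weak closure.** If `F n` (`n ≥ 1`) are continuous functions on `ℝ²` bounded by `B`, and at
the points `k_m → k` each `(F (n+1) k_m)_n` is the moment sequence of a finite positive measure on
`[0, 1]`, then so is `(F (n+1) k)_n`. [folklore] -/
theorem slabHausdorff_of_limit {F : ℕ → (Fin 2 → ℝ) → ℝ} {B : ℝ}
    (hcont : ∀ n, 1 ≤ n → Continuous (F n)) (hbd : ∀ n k, 1 ≤ n → F n k ≤ B)
    {k : Fin 2 → ℝ} {km : ℕ → Fin 2 → ℝ} (hkm : Tendsto km atTop (𝓝 k))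
    (hH : ∀ m, ∃ τ : Measure ℝ, IsFiniteMeasure τ ∧ τ (Set.Icc (0 : ℝ) 1)ᶜ = 0 ∧
      ∀ n : ℕ, 1 ≤ n → F n (km m) = ∫ t, t ^ (n - 1) ∂τ) :
    ∃ τ : Measure ℝ, IsFiniteMeasure τ ∧ τ (Set.Icc (0 : ℝ) 1)ᶜ = 0 ∧
      ∀ n : ℕ, 1 ≤ n → F n k = ∫ t, t ^ (n - 1) ∂τ := by
  choose τ hτfin hτ0 hτmom using hH
  have hlim : ∀ n, Tendsto (fun m => ∫ t, t ^ n ∂(τ m)) atTop (𝓝 (F (n + 1) k)) := by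
    intro n
    have h1 : Tendsto (fun m => F (n + 1) (km m)) atTop (𝓝 (F (n + 1) k)) :=
      ((hcont (n + 1) (by omega)).tendsto k).comp hkm
    refine h1.congr fun m => ?_
    rw [hτmom m (n + 1) (by omega), Nat.add_sub_cancel]
  have hle : ∀ m n, n ≤ m → ∫ t, t ^ n ∂(τ m) ≤ B := by
    intro m n _
    haveI := hτfin m
    calc ∫ t, t ^ n ∂(τ m) ≤ ∫ t, t ^ 0 ∂(τ m) := (integrable_pow_of_Icc (hτ0 m) n).2
      _ = F 1 (km m) := by rw [hτmom m 1 le_rfl]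
      _ ≤ B := hbd 1 _ le_rfl
  obtain ⟨μ, hμfin, hμ0, hμmom⟩ := exists_hausdorffMeasure_of_momentLimit (fun n => F (n + 1) k) τ hτfin
    (fun m => measure_mono_null (fun t ht => by
      simp only [Set.mem_Iio] at ht; exact fun h => absurd h.1 (not_le.2 ht)) (hτ0 m))
    (fun m n => by haveI := hτfin m; exact (integrable_pow_of_Icc (hτ0 m) n).1) hle hlim
  refine ⟨μ, hμfin, hμ0, fun n hn => ?_⟩
  obtain ⟨n', rfl⟩ := Nat.exists_eq_add_of_le' hn
  rw [Nat.add_sub_cancel]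
  exact hμmom n'

/-! ### The slab modes at a good transverse momentum -/

/-- Off the hyperplanes `k_j = 0` of the open cube the symbol is `< 1` on the whole slab circle.
[folklore] -/
theorem symbol_slab_lt_one {q : Site 3 → ℝ} {P : ℕ → Site 3 → ℝ} {G : Site 3 → ℝ}
    (hq0 : ∀ y, 0 ≤ q y) (hqs : Summable q) (hq1 : ∑' y, q y ≤ 1)
    (hP0 : ∀ z, P 0 z = if z = 0 then 1 else 0) (hPs : ∀ j z, P (j + 1) z = ∑' y, q y * P j (z - y))
    (hGreen : ∀ z, HasSum (fun j => P j z) (G z)) (hGpos : ∀ m : Fin 3, 0 < G (Pi.single m 1))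
    (i : Fin 3) {k : Fin 2 → ℝ} (hk : ∀ j, |k j| < π) (hne : ∃ j, k j ≠ 0) (θ : ℝ) :
    ∑' x : Site 3, q x * Real.cos (phase 3 (Fin.insertNth i θ k : Fin 3 → ℝ) x) < 1 := by
  obtain ⟨j, hj⟩ := hne
  refine symbol_lt_one_of_not_mem_lattice hq0 hqs hq1 hP0 hPs hGreen hGpos ⟨i.succAbove j, fun z hz => ?_⟩
  rw [Fin.insertNth_apply_succAbove] at hz
  have h1 : |(z : ℝ)| * (2 * π) < π := by
    have := hk j; rw [hz, abs_mul, abs_of_pos Real.two_pi_pos] at this; exact this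
  have h2 : |(z : ℝ)| < 1 := by nlinarith [Real.pi_pos, abs_nonneg (z : ℝ)]
  have h3 : z = 0 := by
    have : |z| < 1 := by exact_mod_cast h2
    exact Int.abs_lt_one_iff.mp this
  subst h3
  exact hj (by simpa using hz)

/-- **The slab transforms at a good transverse momentum**: the symbol is `< 1` on the slab circle
and `(h_n(k₀))_n` is a Hausdorff moment sequence. [folklore] -/
theorem slabMoments_of_openCube {q : Site 3 → ℝ} {P : ℕ → Site 3 → ℝ} {G : Site 3 → ℝ}
    (hq0 : ∀ y, 0 ≤ q y) (hqs : Summable q) (hq1 : ∑' y, q y ≤ 1) (hqev : ∀ y, q (-y) = q y)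
    (hP0 : ∀ z, P 0 z = if z = 0 then 1 else 0) (hPs : ∀ j z, P (j + 1) z = ∑' y, q y * P j (z - y))
    (hGreen : ∀ z, HasSum (fun j => P j z) (G z)) (hGpos : ∀ m : Fin 3, 0 < G (Pi.single m 1))
    (i : Fin 3)
    (hHS : ∀ (s : Finset (Fin 2 → ℤ)) (v : (Fin 2 → ℤ) → ℝ), ∃ μ : Measure ℝ, IsFiniteMeasure μ ∧
      μ (Set.Icc (0 : ℝ) 1)ᶜ = 0 ∧ ∀ n : ℕ,
        ∑ x ∈ s, ∑ y ∈ s, v x * v y * G (Fin.insertNth i (n : ℤ) (x - y) : Site 3) = ∫ t, t ^ n ∂μ)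
    {k₀ : Fin 2 → ℝ} (hk₀ : ∀ j, |k₀ j| < π) (hne : ∃ j, k₀ j ≠ 0) :
    (∀ θ : ℝ, ∑' x : Site 3, q x * Real.cos (phase 3 (Fin.insertNth i θ k₀ : Fin 3 → ℝ) x) < 1) ∧
    ∃ μ : Measure ℝ, IsFiniteMeasure μ ∧ μ (Set.Icc (0 : ℝ) 1)ᶜ = 0 ∧ ∀ n : ℕ,
      ∫ θ in (-π)..π, Real.cos (n * θ) /
        (1 - ∑' x : Site 3, q x * Real.cos (phase 3 (Fin.insertNth i θ k₀ : Fin 3 → ℝ) x)) = ∫ t, t ^ n ∂μ := by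
  have hπ := Real.pi_pos
  set φ : (Fin 3 → ℝ) → ℝ := fun ξ => ∑' x : Site 3, q x * Real.cos (phase 3 ξ x) with hφ
  have hφcont : Continuous φ := continuous_fourier_q hqs
  set h : ℕ → (Fin 2 → ℝ) → ℝ := fun n k => ∫ θ in (-π)..π, Real.cos (n * θ) *
    (1 - φ (Fin.insertNth i θ k))⁻¹ with hh
  set K2 := Set.pi Set.univ (fun _ : Fin 2 => Set.Icc (-π) π) with hK2
  -- goodness
  have hlt : ∀ k : Fin 2 → ℝ, (∀ j, |k j| < π) → (∃ j, k j ≠ 0) → ∀ θ, φ (Fin.insertNth i θ k) < 1 :=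
    fun k hk hne θ => symbol_slab_lt_one hq0 hqs hq1 hP0 hPs hGreen hGpos i hk hne θ
  -- the moment hypothesis for the slab transforms
  have hHM : ∀ (s : Finset (Fin 2 → ℤ)) (v : (Fin 2 → ℤ) → ℝ), ∃ ν : Measure ℝ, IsFiniteMeasure ν ∧
      ν (Set.Icc (0 : ℝ) 1)ᶜ = 0 ∧ ∀ n : ℕ, ∫ k in K2,
        h n k * (∑ x ∈ s, ∑ y ∈ s, v x * v y * Real.cos (phase 2 k (x - y))) = ∫ t, t ^ n ∂ν := by
    intro s v
    obtain ⟨μ, hμfin, hμ0, hμmom⟩ := hHS s v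
    refine ⟨((2 * π) ^ 3).toNNReal • μ, inferInstance, by rw [Measure.smul_apply, hμ0, smul_zero], fun n => ?_⟩
    rw [integral_smul_nnreal_measure, ← hμmom n, NNReal.smul_def, smul_eq_mul,
      Real.coe_toNNReal _ (by positivity)]
    exact ((slab_form_eq_integral hq0 hqs hq1 hqev hP0 hPs hGreen i s v n).2).symm
  have hint : ∀ n, IntegrableOn (h n) K2 volume := fun n =>
    (slab_form_eq_integral hq0 hqs hq1 hqev hP0 hPs hGreen i ∅ (fun _ => 0) n).1
  -- continuity at good momenta
  have hcontAt : ∀ (k : Fin 2 → ℝ), (∀ j, |k j| < π) → (∃ j, k j ≠ 0) → ∀ n, ContinuousAt (h n) k := by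
    intro k hk hne n
    obtain ⟨j₀, hj₀⟩ := hne
    have hmax : ∀ j : Fin 2, |k j| ≤ max |k 0| |k 1| := by
      intro j; fin_cases j
      · exact le_max_left _ _
      · exact le_max_right _ _
    have hmargin : 0 < π - max |k 0| |k 1| := by
      have := hk 0; have := hk 1
      rcases le_total |k 0| |k 1| with h | h
      · rw [max_eq_right h]; linarith
      · rw [max_eq_left h]; linarith
    set δ : ℝ := min (|k j₀| / 2) ((π - max |k 0| |k 1|) / 2) with hδ
    have hδpos : 0 < δ := lt_min (by have := abs_pos.2 hj₀; positivity) (by positivity)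
    have hball : ∀ k' ∈ Metric.closedBall k δ, (∀ j, |k' j| < π) ∧ ∃ j, k' j ≠ 0 := by
      intro k' hk'
      have hd : ∀ j, |k' j - k j| ≤ δ := fun j => by
        have := dist_le_pi_dist k' k j; rw [Real.dist_eq] at this; exact this.trans hk'
      refine ⟨fun j => ?_, ⟨j₀, fun h0 => ?_⟩⟩
      · have h1 := hd j; have h2 := hmax j
        have h3 : δ ≤ (π - max |k 0| |k 1|) / 2 := min_le_right _ _
        have := abs_sub_abs_le_abs_sub (k' j) (k j)
        linarith
      · have h1 := hd j₀
        rw [h0, zero_sub, abs_neg] at h1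
        have h3 : δ ≤ |k j₀| / 2 := min_le_left _ _
        have := abs_pos.2 hj₀
        linarith
    have hpos : ∀ k' ∈ Metric.closedBall k δ, ∀ θ ∈ Set.Icc (-π) π, 0 < 1 - φ (Fin.insertNth i θ k') := by
      intro k' hk' θ _
      obtain ⟨h1, h2⟩ := hball k' hk'
      linarith [hlt k' h1 h2 θ]
    have hc := continuousAt_slab_transform i (Φ := fun ξ => 1 - φ ξ) (by fun_prop) hδpos hpos n
    simp only [div_eq_mul_inv] at hc
    exact hc
  have hk₀' : ∀ j, |(-k₀) j| < π := fun j => by simpa using hk₀ j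
  have hne' : ∃ j, (-k₀) j ≠ 0 := by obtain ⟨j, hj⟩ := hne; exact ⟨j, by simpa using hj⟩
  have heven : ∀ n, h n (-k₀) = h n k₀ := fun n => slab_transform_neg q i n k₀
  obtain ⟨μ₀, hμ₀fin, hμ₀0, hμ₀mom⟩ := exists_hausdorff_measure_at hHM hint hk₀ (hcontAt k₀ hk₀ hne)
    (hcontAt (-k₀) hk₀' hne') heven
  refine ⟨hlt k₀ hk₀ hne, μ₀, hμ₀fin, hμ₀0, fun n => ?_⟩
  rw [← hμ₀mom n]
  simp only [hh, hφ]
  refine intervalIntegral.integral_congr fun θ _ => ?_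
  simp only [div_eq_mul_inv]

/-! ### Slab rows; reduction of momenta -/

/-- `y ↦ ins_i(c, y)` is injective. [folklore] -/
theorem insertNth_right_injective (i : Fin 3) (c : ℤ) :
    Function.Injective fun y : Fin 2 → ℤ => (Fin.insertNth i c y : Site 3) := by
  intro y y' h
  have := congrArg (fun z : Site 3 => fun j => z (i.succAbove j)) h
  simpa [Fin.insertNth_apply_succAbove] using this

/-- **Reduction of momenta**: every `k ∈ ℝ²` is `k' + 2πm` with `k' ∈ [-π,π]²` a limit of momenta of
the punctured open cube `(-π,π)² ∖ {k₀ = 0 on some axis}ᶜ`. [folklore] -/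
theorem exists_reduce_approx (k : Fin 2 → ℝ) : ∃ (k' : Fin 2 → ℝ) (m : Fin 2 → ℤ) (km : ℕ → Fin 2 → ℝ),
    (∀ j, k j = k' j + (m j : ℝ) * (2 * π)) ∧ Tendsto km atTop (𝓝 k') ∧
      ∀ N, (∀ j, |km N j| < π) ∧ ∃ j, km N j ≠ 0 := by
  have hπ := Real.pi_pos
  have h2π : (0 : ℝ) < 2 * π := Real.two_pi_pos
  set k' : Fin 2 → ℝ := fun j => toIocMod h2π (-π) (k j) with hk'
  set m : Fin 2 → ℤ := fun j => toIocDiv h2π (-π) (k j) with hm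
  have hk'le : ∀ j, |k' j| ≤ π := fun j => by
    have h := toIocMod_mem_Ioc h2π (-π) (k j)
    rw [show -π + 2 * π = π by ring] at h
    exact abs_le.2 ⟨h.1.le, h.2⟩
  set c : ℝ := if 0 ≤ k' 0 then π / 2 else -(π / 2) with hc
  have hcabs : |c| = π / 2 := by
    rw [hc]; split_ifs <;> simp [abs_of_pos (half_pos hπ)]
  set s : ℕ → ℝ := fun N => 1 / ((N : ℝ) + 2) with hs
  have hs0 : ∀ N, 0 < s N := fun N => by simp only [hs]; positivity
  have hs1 : ∀ N, s N ≤ 1 / 2 := fun N =>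
    one_div_le_one_div_of_le two_pos (by linarith [(Nat.cast_nonneg N : (0 : ℝ) ≤ N)])
  set km : ℕ → Fin 2 → ℝ := fun N j => (1 - s N) * k' j + s N * (if j = 0 then c else 0) with hkm
  refine ⟨k', m, km, fun j => ?_, ?_, fun N => ⟨fun j => ?_, ⟨0, ?_⟩⟩⟩
  · have := toIocMod_add_toIocDiv_zsmul h2π (-π) (k j)
    simp only [hk', hm, zsmul_eq_mul] at this ⊢
    linarith
  · have hslim : Tendsto s atTop (𝓝 0) := by
      simp only [hs]
      exact tendsto_const_nhds.div_atTop (tendsto_atTop_add_const_right _ _ tendsto_natCast_atTop_atTop)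
    rw [tendsto_pi_nhds]
    intro j
    have h1 : Tendsto (fun N => (1 - s N) * k' j + s N * (if j = 0 then c else 0)) atTop
        (𝓝 ((1 - 0) * k' j + 0 * (if j = 0 then c else 0))) :=
      ((tendsto_const_nhds.sub hslim).mul tendsto_const_nhds).add (hslim.mul tendsto_const_nhds)
    rw [sub_zero, one_mul, zero_mul, add_zero] at h1
    exact h1
  · simp only [hkm]
    have h1 : |(1 - s N) * k' j| ≤ (1 - s N) * π := by
      rw [abs_mul, abs_of_pos (by linarith [hs1 N])]
      exact mul_le_mul_of_nonneg_left (hk'le j) (by linarith [hs1 N])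
    have h2 : |s N * (if j = 0 then c else 0)| ≤ s N * (π / 2) := by
      rw [abs_mul, abs_of_pos (hs0 N)]
      refine mul_le_mul_of_nonneg_left ?_ (hs0 N).le
      split_ifs
      · rw [hcabs]
      · simp; positivity
    calc |(1 - s N) * k' j + s N * (if j = 0 then c else 0)|
        ≤ |(1 - s N) * k' j| + |s N * (if j = 0 then c else 0)| := abs_add_le _ _
      _ ≤ (1 - s N) * π + s N * (π / 2) := add_le_add h1 h2
      _ < π := by nlinarith [hs0 N]
  · simp only [hkm, if_true]
    by_cases h0 : 0 ≤ k' 0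
    · have : c = π / 2 := by simp [hc, h0]
      rw [this]
      have : 0 ≤ (1 - s N) * k' 0 := mul_nonneg (by linarith [hs1 N]) h0
      nlinarith [hs0 N]
    · have : c = -(π / 2) := by simp [hc, h0]
      rw [this]
      push Not at h0
      have : (1 - s N) * k' 0 < 0 := mul_neg_of_pos_of_neg (by linarith [hs1 N]) h0
      nlinarith [hs0 N]

/-- Periodicity of cosine transforms on `ℤ²` under `k ↦ k + 2πm`. [folklore] -/
theorem tsum_mul_cos_periodic (f : (Fin 2 → ℤ) → ℝ) (k' : Fin 2 → ℝ) (m : Fin 2 → ℤ) :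
    ∑' y : Fin 2 → ℤ, f y * Real.cos (phase 2 (fun j => k' j + (m j : ℝ) * (2 * π)) y) =
      ∑' y : Fin 2 → ℤ, f y * Real.cos (phase 2 k' y) := by
  refine tsum_congr fun y => ?_
  congr 1
  have : phase 2 (fun j => k' j + (m j : ℝ) * (2 * π)) y = phase 2 k' y + ((∑ j, m j * y j : ℤ) : ℝ) * (2 * π) := by
    simp only [phase, add_mul, Finset.sum_add_distrib, Int.cast_sum, Int.cast_mul, Finset.sum_mul]
    congr 1
    exact Finset.sum_congr rfl fun j _ => by ring
  rw [this, Real.cos_add_int_mul_two_pi]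

/-- **Registered auxiliary stub `stub_pickInversion_auxGoodMomentum`** (sub-goal of
`stub_pickInversion`): at a good transverse momentum the symbol is `< 1` on the slab circle and the
cosine moments of `1/(1 - φ(ins_i(·, k₀)))` form a Hausdorff moment sequence
(`slabMoments_of_openCube`). [folklore] -/
theorem stub_pickInversion_auxGoodMomentum : ∀ (q : Site 3 → ℝ) (P : ℕ → Site 3 → ℝ) (G : Site 3 → ℝ)
    (i : Fin 3) (k₀ : Fin 2 → ℝ),
    (∀ y, 0 ≤ q y) → Summable q → ∑' y, q y ≤ 1 → (∀ y, q (-y) = q y) →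
    (∀ z, P 0 z = if z = 0 then 1 else 0) → (∀ j z, P (j + 1) z = ∑' y, q y * P j (z - y)) →
    (∀ z, HasSum (fun j => P j z) (G z)) → (∀ m : Fin 3, 0 < G (Pi.single m 1)) →
    (∀ (s : Finset (Fin 2 → ℤ)) (v : (Fin 2 → ℤ) → ℝ), ∃ μ : MeasureTheory.Measure ℝ,
      MeasureTheory.IsFiniteMeasure μ ∧ μ (Set.Icc (0 : ℝ) 1)ᶜ = 0 ∧ ∀ n : ℕ,
        ∑ x ∈ s, ∑ y ∈ s, v x * v y * G (Fin.insertNth i (n : ℤ) (x - y) : Site 3) = ∫ t, t ^ n ∂μ) →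
    (∀ j, |k₀ j| < Real.pi) → (∃ j, k₀ j ≠ 0) →
    ∃ μ : MeasureTheory.Measure ℝ, MeasureTheory.IsFiniteMeasure μ ∧ μ (Set.Icc (0 : ℝ) 1)ᶜ = 0 ∧ ∀ n : ℕ,
      ∫ θ in (-Real.pi)..Real.pi, Real.cos (n * θ) /
        (1 - ∑' x : Site 3, q x * Real.cos (∑ j, (Fin.insertNth i θ k₀ : Fin 3 → ℝ) j * (x j : ℝ))) = ∫ t, t ^ n ∂μ :=
  fun _ _ _ i _ hq0 hqs hq1 hqev hP0 hPs hGreen hGpos hHS hk₀ hne => by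
    have h := (slabMoments_of_openCube hq0 hqs hq1 hqev hP0 hPs hGreen hGpos i hHS hk₀ hne).2
    simpa only [phase] using h

end Summit.CriticalPhenomena.Ising3DConformalLimit.Cruxes.DirectCorrelationStableTail.SelfEnergyPickInversion

end
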